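import Mathlib
import HarnessLib
import Summits.Parity.GeneralizedHardyLittlewood.Theses.LiouvilleMAD
import Summits.Parity.GeneralizedHardyLittlewood.Theorems.FanDecorrelation.Negative.FanDecorrelationBlockVariance

/-!
# `FanDecorrelation` (stmt-Parity-13318) ALONE: the dilation amplifier (block variance with one dilation
# per block position)

Negation-side hardness infrastructure (calibration, not a refutation mechanism) for the crux
`LiouvilleMAD.FanDecorrelation` (route LiouvilleMAD, rank 3), by the line lead c9 (2026-08-17).  Consequences
(the one-point law "square-root saving in the number of dilations", few biased dilations, `_false_of_` form)
are in the sequel `FanDecorrelationDilationLaw`.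

THE AMPLIFIER.  Fix a shift `c`, a scale `M` (`Q = ⌊√M⌋+1`), a block length `K`, DISTINCT dilations
`n₀, …, n_{K−1} ∈ [1, 2M]` and real weights `a₀, …, a_{K−1}`.  Along each progression `m₀ mod j`,
`j ∈ [Q, 2Q)`, form the amplified short block sum in which POSITION `s` OF THE BLOCK CARRIES ITS OWN
DILATION,
`Bamp_j(m₀) = Σ_{s<K} a_s · λ((m₀ + s j)·n_s + c)` (terms outside `(M,2M]` dropped; `m₀ ∈ T_j`, the block
starts of `FanDecorrelationBlockVariance`).  Then (`sum_Bamp`, `sum_j_sum_Bamp_sq`)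
* `Σ_{m₀∈T_j} Bamp_j(m₀) = Σ_s a_s · P c n_s M`  (`P c n M = Σ_{m∈(M,2M]} λ(mn+c)`, the one-point sum),
* `Σ_j Σ_{m₀∈T_j} Bamp_j(m₀)² = Σ_{s,s'<K} a_s a_{s'} · fan c n_s n_{s'} M (s − s')`.
Every OFF-diagonal term `s ≠ s'` is a fan of the crux with NONZERO lag `k = s − s'` and DISTINCT dilations
`n_s ≠ n_{s'}` — exactly the crux's quantifier range — and the diagonal `s = s'` is the lag-`0` fan of one
progression with itself, at most `Q·M`.  (Contrast `BlockVariance.sum_j_sum_B_sq`, whose family blocks also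
produce same-dilation fans at nonzero lag and distinct-dilation fans at lag `0`, both outside the crux and
bounded trivially there — which is why the Siegel mirrors need a bias with `b²V ≥ 4`.)  Cauchy–Schwarz over
the `≤ M + 2KQ` block starts per modulus gives the

AMPLIFIER INEQUALITY (`amplifier_ineq`, from any off-diagonal fan bound `F`; `amplifier_of_fanDecorrelation`
from the crux): `Q·(Σ_s a_s P c n_s M)² ≤ (M + (K−1)·2Q)·((Σ_s a_s²)·QM + (Σ_s |a_s|)²·F)`. [folklore]
-/

noncomputable section

namespace Summit.Parity.GeneralizedHardyLittlewood.Theorems.FanDecorrelation.Negative.DilationAmplifier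

open Finset
open Summit.Parity.GeneralizedHardyLittlewood.Theses.LiouvilleMAD (FanDecorrelation)
open Summit.Parity.GeneralizedHardyLittlewood.Theorems.DilatedTableChowla.Negative (L abs_L_le_one)
open Summit.Parity.GeneralizedHardyLittlewood.Theorems.DilatedChowla.Negative (P abs_P_le)
open Summit.Parity.GeneralizedHardyLittlewood.Theorems.FanDecorrelation.Negative (fan fanDecorrelation_iff)
open Summit.Parity.GeneralizedHardyLittlewood.Theorems.FanDecorrelation.Negative.BlockVariance
  (X fan_eq_sum_X X_eq_ite abs_fan_le T mem_T card_T ite_shift)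

/-! ## §1 The amplified block sums -/

/-- The AMPLIFIED short block sum along the progression `m₀ mod j`: position `s < K` of the block carries
its own dilation `n s` and weight `a s`:
`Bamp(m₀) = Σ_{s<K} Σ_{m∈(M,2M]} [m = m₀ + s·j] · a s · λ(m·(n s) + c)`. -/
def Bamp (c : ℤ) (M K j : ℕ) (n : ℕ → ℕ) (a : ℕ → ℝ) (m₀ : ℤ) : ℝ :=
  ∑ s ∈ range K, ∑ m ∈ Ioc M (2 * M),
    if (m : ℤ) = m₀ + (s : ℤ) * (j : ℤ) then a s * L ((m : ℤ) * (n s) + c) else 0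

/-- `Σ_{m₀∈T_j} Bamp_j(m₀) = Σ_s a_s · P c (n s) M`: every `m ∈ (M,2M]` is hit exactly once at every
position `s`. -/
theorem sum_Bamp (c : ℤ) (M K j : ℕ) (n : ℕ → ℕ) (a : ℕ → ℝ) :
    ∑ m₀ ∈ T M K j, Bamp c M K j n a m₀ = ∑ s ∈ range K, a s * P c (n s) M := by
  unfold Bamp
  rw [sum_comm]
  refine sum_congr rfl fun s hs => ?_
  rw [sum_comm, P, mul_sum]
  refine sum_congr rfl fun m hm => ?_
  have h1 : ∀ m₀ : ℤ,
      (if (m : ℤ) = m₀ + (s : ℤ) * (j : ℤ) then a s * L ((m : ℤ) * (n s) + c) else 0) =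
        if m₀ = (m : ℤ) - (s : ℤ) * (j : ℤ) then a s * L ((m : ℤ) * (n s) + c) else 0 :=
    fun m₀ => ite_shift _ _ _ _
  simp_rw [h1]
  rw [sum_ite_eq' (T M K j) ((m : ℤ) - (s : ℤ) * (j : ℤ)) (fun _ => a s * L ((m : ℤ) * (n s) + c)),
    if_pos (mem_T hm hs)]

/-- The product of two amplified block indicators, summed over the block start, is a weighted lag
indicator. -/
theorem sum_T_ite_mul_ite_amp (c : ℤ) (M K j : ℕ) (n : ℕ → ℕ) (a : ℕ → ℝ) {s s' m m' : ℕ}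
    (hs : s ∈ range K) (hm : m ∈ Ioc M (2 * M)) :
    ∑ m₀ ∈ T M K j,
      (if (m : ℤ) = m₀ + (s : ℤ) * (j : ℤ) then a s * L ((m : ℤ) * (n s) + c) else 0) *
        (if (m' : ℤ) = m₀ + (s' : ℤ) * (j : ℤ) then a s' * L ((m' : ℤ) * (n s') + c) else 0) =
      if (m : ℤ) - m' = ((s : ℤ) - s') * (j : ℤ) then
        (a s * L ((m : ℤ) * (n s) + c)) * (a s' * L ((m' : ℤ) * (n s') + c)) else 0 := by
  have h1 : ∀ m₀ : ℤ,
      (if (m : ℤ) = m₀ + (s : ℤ) * (j : ℤ) then a s * L ((m : ℤ) * (n s) + c) else 0) *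
        (if (m' : ℤ) = m₀ + (s' : ℤ) * (j : ℤ) then a s' * L ((m' : ℤ) * (n s') + c) else 0) =
      if m₀ = (m : ℤ) - (s : ℤ) * (j : ℤ) then
        (if (m' : ℤ) = m₀ + (s' : ℤ) * (j : ℤ) then
          (a s * L ((m : ℤ) * (n s) + c)) * (a s' * L ((m' : ℤ) * (n s') + c)) else 0) else 0 := by
    intro m₀
    by_cases h : (m : ℤ) = m₀ + (s : ℤ) * (j : ℤ)
    · have h0 : m₀ = (m : ℤ) - (s : ℤ) * (j : ℤ) := by linarith
      rw [if_pos h, if_pos h0]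
      by_cases h' : (m' : ℤ) = m₀ + (s' : ℤ) * (j : ℤ)
      · rw [if_pos h', if_pos h']
      · rw [if_neg h', if_neg h', mul_zero]
    · have h0 : ¬ (m₀ = (m : ℤ) - (s : ℤ) * (j : ℤ)) := fun h0 => h (by linarith)
      rw [if_neg h, if_neg h0, zero_mul]
  simp_rw [h1]
  rw [sum_ite_eq' (T M K j) ((m : ℤ) - (s : ℤ) * (j : ℤ)), if_pos (mem_T hm hs)]
  have hiff : ((m' : ℤ) = (m : ℤ) - (s : ℤ) * (j : ℤ) + (s' : ℤ) * (j : ℤ)) ↔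
      ((m : ℤ) - m' = ((s : ℤ) - s') * (j : ℤ)) := by
    rw [sub_mul]
    constructor
    · intro h; linarith
    · intro h; linarith
  by_cases h : (m' : ℤ) = (m : ℤ) - (s : ℤ) * (j : ℤ) + (s' : ℤ) * (j : ℤ)
  · rw [if_pos h, if_pos (hiff.mp h)]
  · rw [if_neg h, if_neg (fun h' => h (hiff.mpr h'))]

/-- EXPANSION at one modulus:
`Σ_{m₀∈T_j} Bamp_j(m₀)² = Σ_{s,s'<K} a_s a_{s'} · X c (n s) (n s') M ((s−s')·j)`. -/
theorem sum_Bamp_sq (c : ℤ) (M K j : ℕ) (n : ℕ → ℕ) (a : ℕ → ℝ) :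
    ∑ m₀ ∈ T M K j, (Bamp c M K j n a m₀) ^ 2 =
      ∑ s ∈ range K, ∑ s' ∈ range K,
        a s * a s' * X c (n s) (n s') M (((s : ℤ) - s') * (j : ℤ)) := by
  -- Step 1: expand the square and move the block start inside.
  have step1 : ∑ m₀ ∈ T M K j, (Bamp c M K j n a m₀) ^ 2 =
      ∑ s ∈ range K, ∑ s' ∈ range K, ∑ m₀ ∈ T M K j,
        (∑ m ∈ Ioc M (2 * M),
            if (m : ℤ) = m₀ + (s : ℤ) * (j : ℤ) then a s * L ((m : ℤ) * (n s) + c) else 0) *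
          (∑ m' ∈ Ioc M (2 * M),
            if (m' : ℤ) = m₀ + (s' : ℤ) * (j : ℤ) then a s' * L ((m' : ℤ) * (n s') + c) else 0) := by
    calc ∑ m₀ ∈ T M K j, (Bamp c M K j n a m₀) ^ 2
        = ∑ m₀ ∈ T M K j, ∑ s ∈ range K, ∑ s' ∈ range K,
            (∑ m ∈ Ioc M (2 * M),
                if (m : ℤ) = m₀ + (s : ℤ) * (j : ℤ) then a s * L ((m : ℤ) * (n s) + c) else 0) *
              (∑ m' ∈ Ioc M (2 * M),
                if (m' : ℤ) = m₀ + (s' : ℤ) * (j : ℤ) then a s' * L ((m' : ℤ) * (n s') + c)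
                else 0) := by
          refine sum_congr rfl fun m₀ _ => ?_
          rw [Bamp, sq, sum_mul_sum]
      _ = ∑ s ∈ range K, ∑ m₀ ∈ T M K j, ∑ s' ∈ range K,
            (∑ m ∈ Ioc M (2 * M),
                if (m : ℤ) = m₀ + (s : ℤ) * (j : ℤ) then a s * L ((m : ℤ) * (n s) + c) else 0) *
              (∑ m' ∈ Ioc M (2 * M),
                if (m' : ℤ) = m₀ + (s' : ℤ) * (j : ℤ) then a s' * L ((m' : ℤ) * (n s') + c)
                else 0) := sum_comm
      _ = _ := by
          refine sum_congr rfl fun s _ => ?_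
          exact sum_comm
  rw [step1]
  refine sum_congr rfl fun s hs => sum_congr rfl fun s' _ => ?_
  -- Step 2: for fixed (s, s'), evaluate the block-start sum.
  calc ∑ m₀ ∈ T M K j,
        (∑ m ∈ Ioc M (2 * M),
            if (m : ℤ) = m₀ + (s : ℤ) * (j : ℤ) then a s * L ((m : ℤ) * (n s) + c) else 0) *
          (∑ m' ∈ Ioc M (2 * M),
            if (m' : ℤ) = m₀ + (s' : ℤ) * (j : ℤ) then a s' * L ((m' : ℤ) * (n s') + c) else 0)
      = ∑ m₀ ∈ T M K j, ∑ m ∈ Ioc M (2 * M), ∑ m' ∈ Ioc M (2 * M),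
          (if (m : ℤ) = m₀ + (s : ℤ) * (j : ℤ) then a s * L ((m : ℤ) * (n s) + c) else 0) *
            (if (m' : ℤ) = m₀ + (s' : ℤ) * (j : ℤ) then a s' * L ((m' : ℤ) * (n s') + c)
              else 0) := by
        refine sum_congr rfl fun m₀ _ => ?_
        rw [sum_mul_sum]
    _ = ∑ m ∈ Ioc M (2 * M), ∑ m₀ ∈ T M K j, ∑ m' ∈ Ioc M (2 * M),
          (if (m : ℤ) = m₀ + (s : ℤ) * (j : ℤ) then a s * L ((m : ℤ) * (n s) + c) else 0) *
            (if (m' : ℤ) = m₀ + (s' : ℤ) * (j : ℤ) then a s' * L ((m' : ℤ) * (n s') + c)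
              else 0) := sum_comm
    _ = ∑ m ∈ Ioc M (2 * M), ∑ m' ∈ Ioc M (2 * M), ∑ m₀ ∈ T M K j,
          (if (m : ℤ) = m₀ + (s : ℤ) * (j : ℤ) then a s * L ((m : ℤ) * (n s) + c) else 0) *
            (if (m' : ℤ) = m₀ + (s' : ℤ) * (j : ℤ) then a s' * L ((m' : ℤ) * (n s') + c)
              else 0) := by
        refine sum_congr rfl fun m _ => ?_
        exact sum_comm
    _ = ∑ m ∈ Ioc M (2 * M), ∑ m' ∈ Ioc M (2 * M),
          (if (m : ℤ) - m' = ((s : ℤ) - s') * (j : ℤ) then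
            (a s * L ((m : ℤ) * (n s) + c)) * (a s' * L ((m' : ℤ) * (n s') + c)) else 0) := by
        refine sum_congr rfl fun m hm => sum_congr rfl fun m' _ => ?_
        exact sum_T_ite_mul_ite_amp c M K j n a hs hm
    _ = ∑ m ∈ Ioc M (2 * M), ∑ m' ∈ Ioc M (2 * M), a s * a s' *
          (if (m : ℤ) - m' = ((s : ℤ) - s') * (j : ℤ) then
            L ((m : ℤ) * (n s) + c) * L ((m' : ℤ) * (n s') + c) else 0) := by
        refine sum_congr rfl fun m _ => sum_congr rfl fun m' _ => ?_
        split_ifs <;> ring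
    _ = a s * a s' * X c (n s) (n s') M (((s : ℤ) - s') * (j : ℤ)) := by
        rw [X_eq_ite, mul_sum]
        refine sum_congr rfl fun m _ => ?_
        rw [mul_sum]

/-- EXPANSION summed over the moduli:
`Σ_j Σ_{T_j} Bamp_j² = Σ_{s,s'<K} a_s a_{s'} · fan c (n s) (n s') M (s − s')` — off the diagonal these are
fans with nonzero lag between the dilations `n s`, `n s'`; on the diagonal the lag-`0` fan of `n s` with
itself. -/
theorem sum_j_sum_Bamp_sq (c : ℤ) (M K : ℕ) (n : ℕ → ℕ) (a : ℕ → ℝ) :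
    ∑ j ∈ Ico (Nat.sqrt M + 1) (2 * (Nat.sqrt M + 1)), ∑ m₀ ∈ T M K j, (Bamp c M K j n a m₀) ^ 2 =
      ∑ s ∈ range K, ∑ s' ∈ range K, a s * a s' * fan c (n s) (n s') M ((s : ℤ) - s') := by
  calc ∑ j ∈ Ico (Nat.sqrt M + 1) (2 * (Nat.sqrt M + 1)), ∑ m₀ ∈ T M K j, (Bamp c M K j n a m₀) ^ 2
      = ∑ j ∈ Ico (Nat.sqrt M + 1) (2 * (Nat.sqrt M + 1)), ∑ s ∈ range K, ∑ s' ∈ range K,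
          a s * a s' * X c (n s) (n s') M (((s : ℤ) - s') * (j : ℤ)) :=
        sum_congr rfl fun j _ => sum_Bamp_sq c M K j n a
    _ = ∑ s ∈ range K, ∑ j ∈ Ico (Nat.sqrt M + 1) (2 * (Nat.sqrt M + 1)), ∑ s' ∈ range K,
          a s * a s' * X c (n s) (n s') M (((s : ℤ) - s') * (j : ℤ)) := sum_comm
    _ = ∑ s ∈ range K, ∑ s' ∈ range K, ∑ j ∈ Ico (Nat.sqrt M + 1) (2 * (Nat.sqrt M + 1)),
          a s * a s' * X c (n s) (n s') M (((s : ℤ) - s') * (j : ℤ)) := by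
        refine sum_congr rfl fun s _ => ?_
        exact sum_comm
    _ = _ := by
        refine sum_congr rfl fun s _ => sum_congr rfl fun s' _ => ?_
        rw [fan_eq_sum_X, mul_sum]

/-! ## §2 The two sides -/

/-- FAN SIDE.  If every off-diagonal fan of the family (`s ≠ s'`, lag `s − s'`) is at most `F` in absolute
value, the expanded amplified variance is at most `(Σ_s a_s²)·QM + (Σ_s |a_s|)²·F` (diagonal fans bounded
trivially by `QM`, `abs_fan_le`). -/
theorem fan_side_amp_le {c : ℤ} {M K : ℕ} {n : ℕ → ℕ} {a : ℕ → ℝ} {F : ℝ} (hF : 0 ≤ F)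
    (hfan : ∀ s ∈ range K, ∀ s' ∈ range K, s ≠ s' →
      |fan c (n s) (n s') M ((s : ℤ) - s')| ≤ F) :
    ∑ s ∈ range K, ∑ s' ∈ range K, a s * a s' * fan c (n s) (n s') M ((s : ℤ) - s') ≤
      (∑ s ∈ range K, a s ^ 2) * (((Nat.sqrt M : ℝ) + 1) * M) + (∑ s ∈ range K, |a s|) ^ 2 * F := by
  -- pointwise bound
  have hpt : ∀ s ∈ range K, ∀ s' ∈ range K,
      a s * a s' * fan c (n s) (n s') M ((s : ℤ) - s') ≤
        (if s = s' then a s ^ 2 * (((Nat.sqrt M : ℝ) + 1) * M) else 0) + |a s| * |a s'| * F := by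
    intro s hs s' hs'
    by_cases hss : s = s'
    · rw [if_pos hss, ← hss]
      have hf : fan c (n s) (n s) M ((s : ℤ) - s) ≤ ((Nat.sqrt M : ℝ) + 1) * M :=
        le_trans (le_abs_self _) (abs_fan_le _ _ _ _ _)
      have ha : 0 ≤ a s * a s := mul_self_nonneg _
      have hprod0 : 0 ≤ |a s| * |a s| * F := by positivity
      have hmul := mul_le_mul_of_nonneg_left hf ha
      nlinarith [hmul, hprod0]
    · rw [if_neg hss, zero_add]
      have hb := hfan s hs s' hs' hss
      calc a s * a s' * fan c (n s) (n s') M ((s : ℤ) - s')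
          ≤ |a s * a s' * fan c (n s) (n s') M ((s : ℤ) - s')| := le_abs_self _
        _ = |a s| * |a s'| * |fan c (n s) (n s') M ((s : ℤ) - s')| := by rw [abs_mul, abs_mul]
        _ ≤ |a s| * |a s'| * F := mul_le_mul_of_nonneg_left hb (by positivity)
  -- sum it
  have hdiag : ∀ s ∈ range K, ∑ s' ∈ range K,
      (if s = s' then a s ^ 2 * (((Nat.sqrt M : ℝ) + 1) * M) else 0) =
        a s ^ 2 * (((Nat.sqrt M : ℝ) + 1) * M) := by
    intro s hs
    rw [sum_ite_eq (range K) s (fun _ => a s ^ 2 * (((Nat.sqrt M : ℝ) + 1) * M)), if_pos hs]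
  calc ∑ s ∈ range K, ∑ s' ∈ range K, a s * a s' * fan c (n s) (n s') M ((s : ℤ) - s')
      ≤ ∑ s ∈ range K, ∑ s' ∈ range K,
          ((if s = s' then a s ^ 2 * (((Nat.sqrt M : ℝ) + 1) * M) else 0) + |a s| * |a s'| * F) :=
        sum_le_sum fun s hs => sum_le_sum fun s' hs' => hpt s hs s' hs'
    _ = ∑ s ∈ range K, (a s ^ 2 * (((Nat.sqrt M : ℝ) + 1) * M) +
          |a s| * ((∑ s' ∈ range K, |a s'|) * F)) := by
        refine sum_congr rfl fun s hs => ?_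
        rw [sum_add_distrib, hdiag s hs, sum_mul, mul_sum]
        congr 1
        refine sum_congr rfl fun s' _ => ?_
        ring
    _ = (∑ s ∈ range K, a s ^ 2) * (((Nat.sqrt M : ℝ) + 1) * M) + (∑ s ∈ range K, |a s|) ^ 2 * F := by
        rw [sum_add_distrib, ← sum_mul, ← sum_mul, sq]
        ring

/-- BLOCK SIDE (Cauchy–Schwarz at one modulus): `(Σ_s a_s P c (n s) M)² ≤ #T_j · Σ_{T_j} Bamp_j²`. -/
theorem block_side_amp_ge (c : ℤ) (M K j : ℕ) (n : ℕ → ℕ) (a : ℕ → ℝ) :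
    (∑ s ∈ range K, a s * P c (n s) M) ^ 2 ≤
      ((T M K j).card : ℝ) * ∑ m₀ ∈ T M K j, (Bamp c M K j n a m₀) ^ 2 := by
  rw [← sum_Bamp c M K j n a]
  have h := sum_mul_sq_le_sq_mul_sq (T M K j) (fun _ => (1 : ℝ)) (fun m₀ => Bamp c M K j n a m₀)
  simp only [one_mul, one_pow, sum_const, nsmul_eq_mul, mul_one] at h
  exact h

/-! ## §3 The amplifier inequality -/

/-- **The dilation amplifier.**  For distinct-position dilations `n s` and weights `a s`, `s < K` (`K ≥ 1`),
and ANY bound `F ≥ 0` on the off-diagonal fans `|fan c (n s) (n s') M (s − s')|`, `s ≠ s'`: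
`Q·(Σ_s a_s · P c (n s) M)² ≤ (M + (K−1)·2Q)·((Σ_s a_s²)·QM + (Σ_s |a_s|)²·F)`, `Q = ⌊√M⌋+1`. -/
theorem amplifier_ineq {c : ℤ} {M K : ℕ} (hK : 1 ≤ K) (n : ℕ → ℕ) (a : ℕ → ℝ) {F : ℝ} (hF : 0 ≤ F)
    (hfan : ∀ s ∈ range K, ∀ s' ∈ range K, s ≠ s' →
      |fan c (n s) (n s') M ((s : ℤ) - s')| ≤ F) :
    ((Nat.sqrt M : ℝ) + 1) * (∑ s ∈ range K, a s * P c (n s) M) ^ 2 ≤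
      ((M : ℝ) + ((K : ℝ) - 1) * (2 * ((Nat.sqrt M : ℝ) + 1))) *
        ((∑ s ∈ range K, a s ^ 2) * (((Nat.sqrt M : ℝ) + 1) * M) +
          (∑ s ∈ range K, |a s|) ^ 2 * F) := by
  have hside := fan_side_amp_le (c := c) (M := M) (n := n) (a := a) hF hfan
  obtain ⟨Qr, hQr⟩ : ∃ Qr : ℝ, Qr = (Nat.sqrt M : ℝ) + 1 := ⟨_, rfl⟩
  rw [← hQr] at hside ⊢
  have hK' : (0 : ℝ) ≤ (K : ℝ) - 1 := by
    have : (1 : ℝ) ≤ K := by exact_mod_cast hK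
    linarith
  have hQ0 : 0 ≤ Qr := by rw [hQr]; positivity
  have hN₀0 : 0 ≤ (M : ℝ) + ((K : ℝ) - 1) * (2 * Qr) := by positivity
  have hJcard : ((Ico (Nat.sqrt M + 1) (2 * (Nat.sqrt M + 1))).card : ℝ) = Qr := by
    have hc' : (Ico (Nat.sqrt M + 1) (2 * (Nat.sqrt M + 1))).card = Nat.sqrt M + 1 := by
      rw [Nat.card_Ico]; omega
    rw [hc', hQr]; push_cast; ring
  -- per-modulus Cauchy–Schwarz with the uniform bound on `#T_j`
  have hblock : ∀ j ∈ Ico (Nat.sqrt M + 1) (2 * (Nat.sqrt M + 1)),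
      (∑ s ∈ range K, a s * P c (n s) M) ^ 2 ≤
        ((M : ℝ) + ((K : ℝ) - 1) * (2 * Qr)) * ∑ m₀ ∈ T M K j, (Bamp c M K j n a m₀) ^ 2 := by
    intro j hj
    have hjlt : (j : ℝ) ≤ 2 * Qr := by
      rw [mem_Ico] at hj
      have : (j : ℝ) < ((2 * (Nat.sqrt M + 1) : ℕ) : ℝ) := by exact_mod_cast hj.2
      push_cast at this
      rw [hQr]; linarith
    have hT : ((T M K j).card : ℝ) ≤ (M : ℝ) + ((K : ℝ) - 1) * (2 * Qr) := by
      rw [card_T M K j hK]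
      have := mul_le_mul_of_nonneg_left hjlt hK'
      linarith
    have hnn : 0 ≤ ∑ m₀ ∈ T M K j, (Bamp c M K j n a m₀) ^ 2 := sum_nonneg fun _ _ => sq_nonneg _
    calc (∑ s ∈ range K, a s * P c (n s) M) ^ 2
        ≤ ((T M K j).card : ℝ) * ∑ m₀ ∈ T M K j, (Bamp c M K j n a m₀) ^ 2 :=
          block_side_amp_ge c M K j n a
      _ ≤ ((M : ℝ) + ((K : ℝ) - 1) * (2 * Qr)) * ∑ m₀ ∈ T M K j, (Bamp c M K j n a m₀) ^ 2 :=
          mul_le_mul_of_nonneg_right hT hnn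
  calc Qr * (∑ s ∈ range K, a s * P c (n s) M) ^ 2
      = ∑ _j ∈ Ico (Nat.sqrt M + 1) (2 * (Nat.sqrt M + 1)), (∑ s ∈ range K, a s * P c (n s) M) ^ 2 := by
        rw [sum_const, nsmul_eq_mul, hJcard]
    _ ≤ ∑ j ∈ Ico (Nat.sqrt M + 1) (2 * (Nat.sqrt M + 1)),
          ((M : ℝ) + ((K : ℝ) - 1) * (2 * Qr)) * ∑ m₀ ∈ T M K j, (Bamp c M K j n a m₀) ^ 2 :=
        sum_le_sum hblock
    _ = ((M : ℝ) + ((K : ℝ) - 1) * (2 * Qr)) * ∑ j ∈ Ico (Nat.sqrt M + 1) (2 * (Nat.sqrt M + 1)),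
          ∑ m₀ ∈ T M K j, (Bamp c M K j n a m₀) ^ 2 := by rw [mul_sum]
    _ = ((M : ℝ) + ((K : ℝ) - 1) * (2 * Qr)) *
          ∑ s ∈ range K, ∑ s' ∈ range K, a s * a s' * fan c (n s) (n s') M ((s : ℤ) - s') := by
        rw [sum_j_sum_Bamp_sq]
    _ ≤ ((M : ℝ) + ((K : ℝ) - 1) * (2 * Qr)) *
          ((∑ s ∈ range K, a s ^ 2) * (Qr * M) + (∑ s ∈ range K, |a s|) ^ 2 * F) :=
        mul_le_mul_of_nonneg_left hside hN₀0

/-- **The amplifier under the crux.**  `FanDecorrelation` bounds every off-diagonal fan of a family of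
DISTINCT dilations in `[1, 2M]` by `C·M^{3/4+ϑ}`, whence
`Q·(Σ_s a_s P c (n s) M)² ≤ (M + (K−1)·2Q)·((Σ a_s²)·QM + (Σ|a_s|)²·C·M^{3/4+ϑ})`. -/
theorem amplifier_of_fanDecorrelation (hFD : FanDecorrelation) {c : ℤ} (hc : c ≠ 0) :
    ∃ ϑ : ℝ, ϑ < 1 / 4 ∧ ∃ C : ℝ, 0 ≤ C ∧ ∀ (M K : ℕ) (n : ℕ → ℕ) (a : ℕ → ℝ), 1 ≤ K →
      (∀ s ∈ range K, 1 ≤ n s ∧ n s ≤ 2 * M) →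
      (∀ s ∈ range K, ∀ s' ∈ range K, n s = n s' → s = s') →
        ((Nat.sqrt M : ℝ) + 1) * (∑ s ∈ range K, a s * P c (n s) M) ^ 2 ≤
          ((M : ℝ) + ((K : ℝ) - 1) * (2 * ((Nat.sqrt M : ℝ) + 1))) *
            ((∑ s ∈ range K, a s ^ 2) * (((Nat.sqrt M : ℝ) + 1) * M) +
              (∑ s ∈ range K, |a s|) ^ 2 * (C * (M : ℝ) ^ (3 / 4 + ϑ))) := by
  obtain ⟨ϑ, hϑ, C, hCfan⟩ := fanDecorrelation_iff.mp hFD c hc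
  refine ⟨ϑ, hϑ, max C 0, le_max_right _ _, ?_⟩
  intro M K n a hK hn hinj
  have hMnn : (0 : ℝ) ≤ (M : ℝ) ^ (3 / 4 + ϑ) := Real.rpow_nonneg (Nat.cast_nonneg M) _
  have hF : 0 ≤ max C 0 * (M : ℝ) ^ (3 / 4 + ϑ) := mul_nonneg (le_max_right _ _) hMnn
  refine amplifier_ineq hK n a hF ?_
  intro s hs s' hs' hss
  have h1 := hn s hs
  have h2 := hn s' hs'
  have hne : n s ≠ n s' := fun h => hss (hinj s hs s' hs' h)
  have hk : ((s : ℤ) - s') ≠ 0 := by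
    intro h
    apply hss
    exact_mod_cast (sub_eq_zero.mp h)
  have h := hCfan M (n s) (n s') ((s : ℤ) - s') h1.1 h2.1 hne h1.2 h2.2 hk
  exact le_trans h (mul_le_mul_of_nonneg_right (le_max_left _ _) hMnn)

end Summit.Parity.GeneralizedHardyLittlewood.Theorems.FanDecorrelation.Negative.DilationAmplifier

end
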